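import Literature.Analysis.FluidPDE.ClassicalSolution
import Literature.Analysis.FluidPDE.RapidDecayLemmas
import Summits.NavierStokesRegularity.NavierStokesRegularity.Theorems.SelfMixingDichotomyMixingPayoffAdvectionDiffusionGlobal
import Summits.NavierStokesRegularity.NavierStokesRegularity.Theorems.SelfMixingDichotomyMixingPayoffAdvectionDiffusionExtension
import Summits.NavierStokesRegularity.NavierStokesRegularity.Theorems.SelfMixingDichotomyMixingPayoffAdvectionDiffusionWeight
import Summits.NavierStokesRegularity.NavierStokesRegularity.Theorems.SelfMixingDichotomyMixingPayoffAdvectionDiffusionConjCoeff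
import Summits.NavierStokesRegularity.NavierStokesRegularity.Theorems.SelfMixingDichotomyMixingPayoffAdvectionDiffusionConjIdent
import HarnessLib

/-!
# Crux `MixingPayoff` (stmt-NavierStokesRegularity-1422), line `birth`: STUB W2
  `stub_advectionDiffusionSchwartz` — the Cauchy problem for advection–diffusion with a
  `C_b^∞` drift in the Schwartz-type class

Lands `--supports stmt-NavierStokesRegularity-1422` the registered stub
`stub_advectionDiffusionSchwartz` of the lead's skeleton `Cruxes/MixingPayoff/Lines/birth.lean`:
for `a < b`, a drift `v : ℝ → ℝ³ → ℝ³` jointly `C^∞` on the closed slab `[a, b] × ℝ³` with all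
space–time derivatives (within the slab) bounded, and a `C_c^∞` datum `θ₀`, there is a solution
`θ` of `∂ₜθ + ⟪v, ∇θ⟫ = Δθ` on `[a, b] × ℝ³` (one-sided time derivative within `[a, b]`),
jointly `C^∞` on the closed slab, with Schwartz-type decay of all space–time derivatives
uniformly in `t` (`HasUniformRapidDecayOn`), and `θ(a) = θ₀` (Friedman 1964, Ch. 1 Thm. 12
with Ch. 3 Thm. 11 and Ch. 9 Thms. 7–8 — here PROVED from the tree's heat-semigroup machinery).

Proof (the helper files `…AdvectionDiffusion*`): extend the drift to a `C_b^∞` field `ṽ` on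
`ℝ × ℝ³` (Seeley, `exists_cb_extension`); take the exponential weight `w` (`exists_weight`:
`‖x‖ − 3 ≤ w`, derivatives of order `≥ 1` bounded, `‖Dⁿe^{-w}‖ ≤ Cₙ e^{-w}`); solve the
conjugated LINEAR equation `∂ₜψ = Δψ + Dψ[β] + γψ`, `β = −(ṽ + 2∇w)`,
`γ = ⟪ṽ, ∇w⟫ + ‖∇w‖² − Δw` (coefficients `C_b^∞`, `conj_coefficients`) from the datum `e^{w}θ₀`
on `[a, b + 1)` (`linear_global`: windows of the clock-augmented semilinear solver chained by
uniqueness), with all joint derivatives bounded on the closed slab (`uniform_joint_bounds`,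
`uniform_within_bounds`); set `θ = e^{-w}ψ`. Then `θ` is jointly smooth, its derivatives within
the slab are `O(e^{-w}) = O(e^{-‖x‖})` (Leibniz), beating every polynomial weight, the equation
holds on `(a, b]` by the conjugation identities (`gradient_exp_neg_mul`,
`laplacian_exp_neg_mul`) and at `t = a` by continuity of all its terms, and `θ(a) = θ₀`.
-/

noncomputable section

open Literature.Analysis.FluidPDE MeasureTheory Set Function Metric Filter Topology
open scoped ContDiff InnerProductSpace Laplacian Nat

-- `Summit = Problem` for this summit; the tree lakefile sets `weak.linter.dupNamespace = false`.
set_option linter.dupNamespace false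

namespace Summit.NavierStokesRegularity.NavierStokesRegularity.Theorems

open SelfMixingDichotomy.MixingPayoffBirth

local notation "E3" => EuclideanSpace ℝ (Fin 3)

/-- Polynomial weights against the exponential: `(1 + r)^K e^{-r} ≤ e · K!` for `r ≥ 0`. -/
theorem one_add_pow_mul_exp_neg_le {r : ℝ} (hr : 0 ≤ r) (K : ℕ) :
    (1 + r) ^ K * Real.exp (-r) ≤ Real.exp 1 * K ! := by
  have h := Real.pow_div_factorial_le_exp (x := 1 + r) (by linarith) K
  rw [div_le_iff₀ (by positivity)] at h
  have he : Real.exp (1 + r) = Real.exp 1 * Real.exp r := Real.exp_add 1 r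
  have hmul : (1 + r) ^ K * Real.exp (-r) * Real.exp r = (1 + r) ^ K := by
    rw [mul_assoc, ← Real.exp_add, neg_add_cancel, Real.exp_zero, mul_one]
  have hpos := Real.exp_pos r
  nlinarith [Real.exp_pos 1, Nat.cast_nonneg' (α := ℝ) (K !)]

set_option maxHeartbeats 1600000 in
/-- **STUB W2 — the Cauchy problem for advection–diffusion with a `C_b^∞` drift in the
Schwartz-type class** (Friedman 1964, Ch. 1 §7 Thm. 12; Ch. 3 §5 Thm. 11; Ch. 9 §6
Thms. 7–8; proved here through the tree's heat-semigroup machinery, see the module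
docstring). -/
theorem stub_advectionDiffusionSchwartz :
    ∀ (a b : ℝ), a < b → ∀ (v : ℝ → E3 → E3), IsSmoothSpaceTimeOn (Set.Icc a b) v →
    (∀ n : ℕ, ∃ C : ℝ, ∀ t ∈ Set.Icc a b, ∀ x : E3,
      ‖iteratedFDerivWithin ℝ n (Function.uncurry v) (Set.Icc a b ×ˢ Set.univ) (t, x)‖ ≤ C) →
    ∀ θ₀ : E3 → ℝ, ContDiff ℝ ∞ θ₀ → HasCompactSupport θ₀ →
    ∃ θ : ℝ → E3 → ℝ, IsSmoothSpaceTimeOn (Set.Icc a b) θ ∧ HasUniformRapidDecayOn (Set.Icc a b) θ ∧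
      (∀ t ∈ Set.Icc a b, ∀ x : E3,
        timeDerivWithin (Set.Icc a b) θ t x + inner ℝ (v t x) (gradient (θ t) x)
          = Laplacian.laplacian (θ t) x) ∧
      θ a = θ₀ := by
  intro a b hab v hv hvb θ₀ hθ₀ hθ₀c
  have hS : UniqueDiffOn ℝ (Icc a b) := uniqueDiffOn_Icc hab
  have hSU : UniqueDiffOn ℝ (Icc a b ×ˢ (univ : Set E3)) := hS.prod uniqueDiffOn_univ
  -- ### 1. the extended drift
  have hvb' : ∀ n, ∃ C, ∀ p ∈ Icc a b ×ˢ (univ : Set E3),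
      ‖iteratedFDerivWithin ℝ n (uncurry v) (Icc a b ×ˢ univ) p‖ ≤ C := fun n => by
    obtain ⟨C, hC⟩ := hvb n
    exact ⟨C, fun p hp => hC p.1 hp.1 p.2⟩
  obtain ⟨vt, hvts, hvtb, hvteq⟩ := exists_cb_extension hab hv hvb'
  -- ### 2. the weight and the conjugated problem
  obtain ⟨w, hws, hwge, hwb, hweb⟩ := exists_weight E3
  set β : ℝ → E3 → E3 := fun t x => -(vt t x + (2 : ℝ) • gradient w x) with hβ
  set γ : ℝ → E3 → ℝ := fun t x => ⟪vt t x, gradient w x⟫_ℝ + ⟪gradient w x, gradient w x⟫_ℝ - (Δ w) x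
    with hγ
  obtain ⟨⟨hβs, hβb⟩, ⟨hγs, hγb⟩⟩ := conj_coefficients hvts hvtb hws hwb hβ hγ
  have hψ₀ : ∀ n, ∃ A, IsCkBounded n A (fun x => Real.exp (w x) * θ₀ x) := fun n =>
    isCkBounded_exp_mul hθ₀ hθ₀c hws n
  have hab1 : a < b + 1 := by linarith
  obtain ⟨ψ, hψ0, hψs, hψeq, -, hψsl⟩ := linear_global hβs hγs hβb hγb hab1 _ hψ₀
  -- bounds on all joint derivatives within the closed slab
  have hψwb : ∀ n, ∃ C, ∀ p ∈ Icc a b ×ˢ (univ : Set E3),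
      ‖iteratedFDerivWithin ℝ n (uncurry ψ) (Icc a b ×ˢ univ) p‖ ≤ C := fun n => by
    obtain ⟨C, hC⟩ := uniform_joint_bounds hβs hγs hβb hγb hψs hψeq hψsl n
    exact ⟨C, uniform_within_bounds hab (by linarith) hψs hC⟩
  have hψS : IsSmoothSpaceTimeOn (Icc a b) ψ :=
    hψs.mono (prod_mono (Icc_subset_Ico_right (by linarith)) Subset.rfl)
  have hψ2 : ∀ t ∈ Icc a b, ContDiff ℝ 2 (ψ t) := fun t ht => by
    obtain ⟨A, hA⟩ := hψsl 2; exact (hA t ⟨ht.1, by linarith [ht.2]⟩).contDiff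
  -- ### 3. the solution `θ = e^{-w} ψ`
  have he : ContDiff ℝ ∞ fun p : ℝ × E3 => Real.exp (-w p.2) :=
    Real.contDiff_exp.comp (hws.comp contDiff_snd).neg
  refine ⟨fun t x => Real.exp (-w x) * ψ t x, ?_, ?_, ?_, ?_⟩
  · -- joint smoothness
    exact he.contDiffOn.mul hψS
  · -- ### decay of all derivatives
    intro n K
    -- uniform bounds of order `≤ n`
    choose Cψ hCψ using hψwb
    choose Ce hCe using hweb
    set Aψ : ℝ := ∑ j ∈ Finset.range (n + 1), |Cψ j| with hAψ
    set Ae : ℝ := ∑ j ∈ Finset.range (n + 1), |Ce j| with hAe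
    have hAψj : ∀ j ≤ n, ∀ p ∈ Icc a b ×ˢ (univ : Set E3),
        ‖iteratedFDerivWithin ℝ j (uncurry ψ) (Icc a b ×ˢ univ) p‖ ≤ Aψ := fun j hj p hp =>
      ((hCψ j p hp).trans (le_abs_self _)).trans (Finset.single_le_sum (f := fun j => |Cψ j|)
        (fun _ _ => abs_nonneg _) (Finset.mem_range.2 (Nat.lt_succ_of_le hj)))
    have hAej : ∀ j ≤ n, ∀ p : ℝ × E3,
        ‖iteratedFDeriv ℝ j (fun p : ℝ × E3 => Real.exp (-w p.2)) p‖ ≤ Ae * Real.exp (-w p.2) := by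
      intro j hj p
      have h1 : ‖iteratedFDeriv ℝ j (fun p : ℝ × E3 => Real.exp (-w p.2)) p‖ ≤ Ce j * Real.exp (-w p.2) := by
        rw [show (fun p : ℝ × E3 => Real.exp (-w p.2)) = (fun x => Real.exp (-w x)) ∘ (ContinuousLinearMap.snd ℝ ℝ E3)
            from rfl,
          (ContinuousLinearMap.snd ℝ ℝ E3).iteratedFDeriv_comp_right
            (by exact Real.contDiff_exp.comp hws.neg : ContDiff ℝ ∞ fun x => Real.exp (-w x)) p
            (mod_cast le_top)]
        refine (ContinuousMultilinearMap.norm_compContinuousLinearMap_le _ _).trans ?_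
        rw [Finset.prod_const, Finset.card_univ, Fintype.card_fin]
        have hsnd : ‖ContinuousLinearMap.snd ℝ ℝ E3‖ ^ j ≤ 1 := pow_le_one₀ (norm_nonneg _)
          (ContinuousLinearMap.norm_snd_le ℝ ℝ E3)
        calc _ ≤ Ce j * Real.exp (-w p.2) * 1 := by
              refine mul_le_mul (hCe j p.2) hsnd (by positivity) ?_
              exact (norm_nonneg _).trans (hCe j p.2)
          _ = _ := mul_one _
      refine h1.trans (mul_le_mul_of_nonneg_right ?_ (Real.exp_pos _).le)
      exact (le_abs_self _).trans (Finset.single_le_sum (f := fun j => |Ce j|)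
        (fun _ _ => abs_nonneg _) (Finset.mem_range.2 (Nat.lt_succ_of_le hj)))
    have hAψ0 : 0 ≤ Aψ := Finset.sum_nonneg fun _ _ => abs_nonneg _
    have hAe0 : 0 ≤ Ae := Finset.sum_nonneg fun _ _ => abs_nonneg _
    refine ⟨2 ^ n * Ae * Aψ * (Real.exp (Module.finrank ℝ E3 : ℝ) * (Real.exp 1 * K !)), fun t ht x => ?_⟩
    have hp : ((t, x) : ℝ × E3) ∈ Icc a b ×ˢ (univ : Set E3) := ⟨ht, mem_univ _⟩
    -- Leibniz within the slab
    have hL := norm_iteratedFDerivWithin_mul_le he.contDiffOn hψS hSU hp (n := n) (mod_cast le_top)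
    have hmain : ‖iteratedFDerivWithin ℝ n (uncurry fun t x => Real.exp (-w x) * ψ t x) (Icc a b ×ˢ univ) (t, x)‖ ≤
        2 ^ n * Ae * Aψ * Real.exp (-w x) := by
      have hfun : (uncurry fun t x => Real.exp (-w x) * ψ t x) =
          fun p : ℝ × E3 => (fun p : ℝ × E3 => Real.exp (-w p.2)) p * uncurry ψ p := by
        funext p; rfl
      rw [hfun]
      refine hL.trans ?_
      have hsum : ∑ i ∈ Finset.range (n + 1), (n.choose i : ℝ) *
          ‖iteratedFDerivWithin ℝ i (fun p : ℝ × E3 => Real.exp (-w p.2)) (Icc a b ×ˢ univ) (t, x)‖ *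
          ‖iteratedFDerivWithin ℝ (n - i) (uncurry ψ) (Icc a b ×ˢ univ) (t, x)‖ ≤
          ∑ i ∈ Finset.range (n + 1), (n.choose i : ℝ) * (Ae * Real.exp (-w x) * Aψ) := by
        refine Finset.sum_le_sum fun i hi => ?_
        have hin : i ≤ n := Nat.lt_succ_iff.1 (Finset.mem_range.1 hi)
        rw [mul_assoc, iteratedFDerivWithin_eq_iteratedFDeriv hSU (he.contDiffAt.of_le (mod_cast le_top)) hp]
        refine mul_le_mul_of_nonneg_left ?_ (by positivity)
        exact mul_le_mul (hAej i hin (t, x)) (hAψj (n - i) (Nat.sub_le n i) _ hp) (norm_nonneg _)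
          (by positivity)
      refine hsum.trans ?_
      rw [← Finset.sum_mul]
      have h2 : ∑ i ∈ Finset.range (n + 1), (n.choose i : ℝ) = 2 ^ n := by exact_mod_cast Nat.sum_range_choose n
      rw [h2]
      nlinarith [Real.exp_pos (-w x)]
    -- the weights
    have hwx := hwge x
    have hexp : Real.exp (-w x) ≤ Real.exp (Module.finrank ℝ E3 : ℝ) * Real.exp (-‖x‖) := by
      rw [← Real.exp_add]; exact Real.exp_le_exp.2 (by linarith)
    have hpoly := one_add_pow_mul_exp_neg_le (norm_nonneg x) K
    calc (1 + ‖x‖) ^ K * ‖iteratedFDerivWithin ℝ n (uncurry fun t x => Real.exp (-w x) * ψ t x)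
          (Icc a b ×ˢ univ) (t, x)‖
        ≤ (1 + ‖x‖) ^ K * (2 ^ n * Ae * Aψ * Real.exp (-w x)) :=
          mul_le_mul_of_nonneg_left hmain (by positivity)
      _ ≤ (1 + ‖x‖) ^ K * (2 ^ n * Ae * Aψ * (Real.exp (Module.finrank ℝ E3 : ℝ) * Real.exp (-‖x‖))) := by
          gcongr
      _ = 2 ^ n * Ae * Aψ * Real.exp (Module.finrank ℝ E3 : ℝ) * ((1 + ‖x‖) ^ K * Real.exp (-‖x‖)) := by ring
      _ ≤ 2 ^ n * Ae * Aψ * Real.exp (Module.finrank ℝ E3 : ℝ) * (Real.exp 1 * K !) := by gcongr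
      _ = _ := by ring
  · -- ### the equation
    have hθS : IsSmoothSpaceTimeOn (Icc a b) (fun t x => Real.exp (-w x) * ψ t x) := he.contDiffOn.mul hψS
    -- the identity on `(a, b]`
    have key : ∀ t ∈ Ioc a b, ∀ x : E3,
        timeDerivWithin (Icc a b) (fun t x => Real.exp (-w x) * ψ t x) t x +
          ⟪v t x, gradient (fun y => Real.exp (-w y) * ψ t y) x⟫_ℝ = (Δ (fun y => Real.exp (-w y) * ψ t y)) x := by
      intro t ht x
      have htI : t ∈ Icc a b := Ioc_subset_Icc_self ht
      have hto : t ∈ Ioo a (b + 1) := ⟨ht.1, by linarith [ht.2]⟩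
      have hd := (hψeq t hto x).const_mul (Real.exp (-w x))
      have hderiv : timeDerivWithin (Icc a b) (fun t x => Real.exp (-w x) * ψ t x) t x =
          Real.exp (-w x) * ((Δ (ψ t)) x + fderiv ℝ (ψ t) x (β t x) + γ t x * ψ t x) :=
        hd.hasDerivWithinAt.derivWithin (hS t htI)
      have hwd : DifferentiableAt ℝ w x := (hws.differentiable (by simp)) x
      have hψd : DifferentiableAt ℝ (ψ t) x := ((hψ2 t htI).differentiable (by norm_num)) x
      have hgrad := gradient_exp_neg_mul hwd hψd (g := ψ t)
      have hlap := laplacian_exp_neg_mul hws (g := ψ t) (x := x) (hψ2 t htI).contDiffAt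
      have hvt : vt t x = v t x := congrFun (hvteq t htI) x
      have hfd : fderiv ℝ (ψ t) x (β t x) =
          -⟪v t x, gradient (ψ t) x⟫_ℝ - 2 * ⟪gradient w x, gradient (ψ t) x⟫_ℝ := by
        rw [fderiv_apply_eq_inner_gradient, hβ]
        simp only [hvt, inner_neg_right, inner_add_right, inner_smul_right, real_inner_comm (gradient (ψ t) x)]
        ring
      have hγx : γ t x = ⟪v t x, gradient w x⟫_ℝ + ‖gradient w x‖ ^ 2 - (Δ w) x := by
        simp only [hγ, hvt, real_inner_self_eq_norm_sq]
      rw [hderiv, hgrad, hlap, hfd, hγx, inner_smul_right, inner_sub_right, inner_smul_right]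
      ring
    intro t ht x
    rcases lt_or_eq_of_le ht.1 with hat | hat
    · exact key t ⟨hat, ht.2⟩ x
    · -- at `t = a` by continuity of all terms
      subst hat
      have hc1 := continuousOn_timeDerivWithin_time hθS hS x
      have hc2 := continuousOn_gradient_time hθS hS x
      have hc3 := continuousOn_laplacian_time hθS hS x
      have hcv : ContinuousOn (fun s => v s x) (Icc a b) := hv.continuousOn_time x
      exact eq_at_left_of_eqOn_Ioc hab ((hc1 a ht).add ((hcv a ht).inner (hc2 a ht))) (hc3 a ht)
        (fun s hs => key s hs x)
  · -- ### the initial datum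
    funext x
    show Real.exp (-w x) * ψ a x = θ₀ x
    rw [hψ0, ← mul_assoc, ← Real.exp_add, neg_add_cancel, Real.exp_zero, one_mul]

end Summit.NavierStokesRegularity.NavierStokesRegularity.Theorems

end
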